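import Literature.NumberTheory.Automorphic.Liu2021.ThetaLiftFromLineCoinvariantJunction
import Summits.HodgeConjecture.HodgeConjecture.Theorems.F0LD2ArchAdmissibleAssembly
import HarnessLib

/-!
# Crux `HLiu418`, line LD2 — the PINNED adelic frame transport under the SCALED frame: it IS ★ `cmAdelicFrameTransport` of `t • H` restricted to
# `U(H)(𝔸) = U(t • H)(𝔸)`, hence continuous, rational-to-rational, and with finite part the letters' `(finAdelicCongr … g ht hg).symm`

Cell hodgecm-mathlib (D-0151), FLOOR 0; crux item `HLiu418` = stmt-HodgeConjecture-24832; half-A lines LD1 ∕ LD2 (socket 27458 `F0_AlbCm.lean`).  Seat LD2-p02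
(g0).  THEOREMS ONLY (no `def`, no instance, no notation, no named fact, no `sorry`); `--supports stmt-HodgeConjecture-24832 --as helper`.  HC_CM is proved
only modulo the 7 printed citations (2 remaining: hLiu418, h413) until rung 0 closes; this file discharges nothing printed.

WHY (LD1-p01 (g0) road memo 2026-09-02T02:46:59Z, finding (0) «SCALED-FRAME GAP»; LD2-plan skeleton §0).  The LD organs (A₂, B₂, C₂away, …; LD1's
(R)∕(I)∕(P)) carry an ABSTRACT adelic transport `ιA : U(H)(𝔸_{L⁺}) →* U(diag dV)(𝔸_{L⁺})` PINNED by the matrix formula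
`↑(ιA k) = g_𝔸⁻¹ · k · g_𝔸` under the letters' SCALED frame `formCongr c g (t • H) = diagonal dV`, whereas every ★ theta-road lemma of
`Liu2021/ThetaLiftFromLine*.lean` is stated for the LITERAL ★ `cmAdelicFrameTransport L N H dV g hg` of an UNSCALED frame.  This file identifies the
two (rank-generic `N`): `ιA = cmAdelicFrameTransport L N (t • H) dV g hg′ ∘ (U(H)(𝔸) ↪ U(t•H)(𝔸))` (§2; the inclusion of EQUAL subgroups, ★
`adelicUnitaryGroup_smul`), and derives the three properties the ★ proofs use of the transport — continuity (§3), rational points to rational points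
(§3), and the finite part `(ιA (1, k))_f = g_f⁻¹ k g_f = (finAdelicCongr … g ht hg).symm k`, `ιA (1, k) = (1, (ιA (1,k))_f)` (§4) — so that the kernel
kits re-prove the ★ lemmas for `ιA` by the ★ proofs (`cmAdelicFrameTransport` ↦ `ιA`).

* §1 `adelic_smul_eq`, `finAdelicToAdelic_inclusion`, `toAdelic_inclusion` — `U(t•H) = U(H)` on adelic, finite-adelic and rational points, compatibly;
* §2 **`pin_apply`** (`ιA k = cmAdelicFrameTransport L N (t • H) … (k)`);
* §3 **`continuous_of_pin`**, **`mem_range_toAdelic_of_pin`**;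
* §4 **`coe_finPart_pin`**, **`finPart_pin_eq_finAdelicCongr_symm`**, **`pin_finAdelicToAdelic`**.

## References
* [BorelJacquet1979] A. Borel, H. Jacquet, PSPM 33.1 (1979), §4.1 (`G(𝔸) = G_∞ × G(𝔸_f)`; principal adeles).
* [PlatonovRapinchuk1994] V. Platonov, A. Rapinchuk, *Algebraic Groups and Number Theory* (1994), §2.3 (unitary groups of similar forms), §5.1.
* [Mok2014] C. P. Mok, Mem. AMS 235 (2015), §1 Notation p. 5.
-/

set_option autoImplicit false
-- the mandated namespace has the single-problem summit's repeated segment (`HodgeConjecture.HodgeConjecture`)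
set_option linter.dupNamespace false

noncomputable section

open NumberField NumberField.InfinitePlace IsDedekindDomain
open scoped Matrix

namespace Summit.HodgeConjecture.HodgeConjecture.Cruxes.HLiu418.F0LD2FrameTransportPin

open Literature.NumberTheory.Automorphic Literature.NumberTheory.Automorphic.UnitaryGroup
open Literature.NumberTheory.Automorphic.Liu2021
open Summit.HodgeConjecture.HodgeConjecture.Cruxes.HLiu418.F0LD2ArchAdmissibleAssembly (frame_smul_eq)

variable (L : Type) [Field L] [NumberField L] [IsCMField L] (N : ℕ) (H : Matrix (Fin N) (Fin N) L) (dV : Fin N → L)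
  (t : L) (ht : t ≠ 0) (g : GL (Fin N) L)
  (hg : formCongr ((IsCMField.complexConj L : L ≃ₐ[↥(maximalRealSubfield L)] L) : L →+* L) g (t • H) = Matrix.diagonal dV)
  (ιA : (adelicGroupData (↥(maximalRealSubfield L)) L (IsCMField.complexConj L) N H).Adelic →*
    ↥(UnitaryGroup.adelic (↥(maximalRealSubfield L)) L (IsCMField.complexConj L) N (Matrix.diagonal dV)))
  (hιA : ∀ k, ((ιA k : ↥(UnitaryGroup.adelic (↥(maximalRealSubfield L)) L (IsCMField.complexConj L) N (Matrix.diagonal dV))) :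
      GL (Fin N) (AdeleRing (𝓞 L) L)) =
    (toAdeleGL L g)⁻¹ * adelicVal (↥(maximalRealSubfield L)) L (IsCMField.complexConj L) N H k * toAdeleGL L g)

/-! ## §1 `U(t • H) = U(H)`: adelic, finite-adelic and rational points -/

include ht in
/-- **`U(t • H)(𝔸_{L⁺}) = U(H)(𝔸_{L⁺})`** for `t ≠ 0` (★ `adelic_complexConj` + ★ `adelicUnitaryGroup_smul`). [cite: PlatonovRapinchuk1994, §2.3] -/
theorem adelic_smul_eq :
    UnitaryGroup.adelic (↥(maximalRealSubfield L)) L (IsCMField.complexConj L) N (t • H) =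
      UnitaryGroup.adelic (↥(maximalRealSubfield L)) L (IsCMField.complexConj L) N H := by
  rw [adelic_complexConj, adelic_complexConj, adelicUnitaryGroup_smul L N ht H]

/-- The inclusion `U(H)(𝔸) ↪ U(t•H)(𝔸)` carries `(1, k)` to `(1, k)` (same matrix; `U(H)(𝔸_f) = U(t•H)(𝔸_f)` by ★ `finAdelic_smul`).
[cite: BorelJacquet1979, §4.1] -/
theorem finAdelicToAdelic_inclusion (k : finAdelic (↥(maximalRealSubfield L)) L (IsCMField.complexConj L) N H) :
    Subgroup.inclusion (adelic_smul_eq L N H t ht).ge (finAdelicToAdelic (↥(maximalRealSubfield L)) L (IsCMField.complexConj L) N H k) =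
      finAdelicToAdelic (↥(maximalRealSubfield L)) L (IsCMField.complexConj L) N (t • H)
        ⟨k.1, (finAdelic_smul (↥(maximalRealSubfield L)) L (IsCMField.complexConj L) (N := N) ht H).symm ▸ k.2⟩ :=
  Subtype.ext rfl

/-- The inclusion carries rational points to rational points: `toAdelic H γ ↦ toAdelic (t•H) γ` (`U(H)(L⁺) = U(t•H)(L⁺)`, ★ `rational_smul`).
[cite: PlatonovRapinchuk1994, §2.3] -/
theorem toAdelic_inclusion (γ : rational (↥(maximalRealSubfield L)) L (IsCMField.complexConj L) N H) :
    Subgroup.inclusion (adelic_smul_eq L N H t ht).ge (toAdelic (↥(maximalRealSubfield L)) L (IsCMField.complexConj L) N H γ) =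
      toAdelic (↥(maximalRealSubfield L)) L (IsCMField.complexConj L) N (t • H)
        ⟨γ.1, (rational_smul (↥(maximalRealSubfield L)) L (IsCMField.complexConj L) N ht H).symm ▸ γ.2⟩ :=
  Subtype.ext (Units.ext (by rw [Subgroup.coe_inclusion, coe_toAdelic, coe_toAdelic]))

/-! ## §2 The pinned transport IS `cmAdelicFrameTransport` of `t • H` on `U(H)(𝔸)` -/

include ht hιA in
/-- **`ιA k = cmAdelicFrameTransport L N (t • H) dV g hg′ (k)`** for every `k ∈ U(H)(𝔸) = U(t•H)(𝔸)` — both sides have the matrix `g_𝔸⁻¹ · k · g_𝔸`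
(the pin `hιA`, ★ `coe_cmAdelicFrameTransport`), and the coercion to `GL_N(𝔸_L)` is injective. [cite: Mok2014, §1 Notation p. 5] [cite: PlatonovRapinchuk1994, §2.3] -/
theorem pin_apply (k : (adelicGroupData (↥(maximalRealSubfield L)) L (IsCMField.complexConj L) N H).Adelic) :
    ιA k = cmAdelicFrameTransport L N (t • H) dV g (frame_smul_eq L N H dV t g hg) (Subgroup.inclusion (adelic_smul_eq L N H t ht).ge k) :=
  Subtype.ext (by rw [hιA k, coe_cmAdelicFrameTransport]; rfl)

/-! ## §3 Continuity and rational points -/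

include hιA in
/-- **The pinned transport is continuous** (the matrix `g_𝔸⁻¹ · k · g_𝔸` depends continuously on `k`; subspace topologies).
[cite: BorelJacquet1979, §4.1] -/
theorem continuous_of_pin : Continuous ιA := by
  refine continuous_induced_rng.2 ?_
  have h : (fun k => ((ιA k : ↥(UnitaryGroup.adelic (↥(maximalRealSubfield L)) L (IsCMField.complexConj L) N (Matrix.diagonal dV))) :
      GL (Fin N) (AdeleRing (𝓞 L) L))) =
      fun k => (toAdeleGL L g)⁻¹ * adelicVal (↥(maximalRealSubfield L)) L (IsCMField.complexConj L) N H k * toAdeleGL L g :=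
    funext hιA
  show Continuous fun k => ((ιA k : ↥(UnitaryGroup.adelic (↥(maximalRealSubfield L)) L (IsCMField.complexConj L) N (Matrix.diagonal dV))) :
      GL (Fin N) (AdeleRing (𝓞 L) L))
  rw [h]
  exact (continuous_const.mul continuous_subtype_val).mul continuous_const

include ht hg hιA in
/-- **The pinned transport carries rational points to rational points**: `γ ∈ U(H)(L⁺) ⇒ ιA γ ∈ U(diag dV)(L⁺)` (★
`cmAdelicFrameTransport_mem_range_toAdelic` for `t • H`, §1). [cite: PlatonovRapinchuk1994, §2.3] [cite: Mok2014, §1 Notation p. 5] -/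
theorem mem_range_toAdelic_of_pin {γ : (adelicGroupData (↥(maximalRealSubfield L)) L (IsCMField.complexConj L) N H).Adelic}
    (hγ : γ ∈ (UnitaryGroup.toAdelic (↥(maximalRealSubfield L)) L (IsCMField.complexConj L) N H).range) :
    ιA γ ∈ (UnitaryGroup.toAdelic (↥(maximalRealSubfield L)) L (IsCMField.complexConj L) N (Matrix.diagonal dV)).range := by
  obtain ⟨r, rfl⟩ := hγ
  rw [pin_apply L N H dV t ht g hg ιA hιA, toAdelic_inclusion L N H t ht r]
  exact cmAdelicFrameTransport_mem_range_toAdelic (L := L) (N := N) (H := t • H) (dV := dV) (g := g) ⟨_, rfl⟩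

/-! ## §4 The finite part of the pinned transport -/

include hιA in
/-- **`↑((ιA (1, k))_f) = g_f⁻¹ · k · g_f`** in `GL_N(𝔸_{L,f})` (the finite part of conjugation by the principal adele `g_𝔸 = (g_∞, g_f)`).
[cite: BorelJacquet1979, §4.1] -/
theorem coe_finPart_pin (k : finAdelic (↥(maximalRealSubfield L)) L (IsCMField.complexConj L) N H) :
    ((finPart (↥(maximalRealSubfield L)) L (IsCMField.complexConj L) N (Matrix.diagonal dV)
        (ιA (finAdelicToAdelic (↥(maximalRealSubfield L)) L (IsCMField.complexConj L) N H k)) :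
          finAdelic (↥(maximalRealSubfield L)) L (IsCMField.complexConj L) N (Matrix.diagonal dV)) :
        GL (Fin N) (FiniteAdeleRing (𝓞 L) L)) =
      (toFinAdeleGL L N g)⁻¹ * (k : GL (Fin N) (FiniteAdeleRing (𝓞 L) L)) * toFinAdeleGL L N g := by
  have hsnd : GLn.sndHom N L (toAdeleGL L g) = toFinAdeleGL L N g := Units.ext (Matrix.ext fun _ _ => rfl)
  rw [coe_finPart, adelicVal_apply, hιA, map_mul, map_mul, map_inv, hsnd, adelicVal_finAdelicToAdelic, GLn.sndHom_ofFinite]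

include hιA in
/-- **The finite part of the pinned transport IS the letters' finite transport**: `(ιA (1, k))_f = (finAdelicCongr … g ht hg).symm k` (both are
`g_f⁻¹ k g_f`, ★ `coe_finAdelicCongr_symm_apply`). [cite: PlatonovRapinchuk1994, §2.3] -/
theorem finPart_pin_eq_finAdelicCongr_symm (k : finAdelic (↥(maximalRealSubfield L)) L (IsCMField.complexConj L) N H) :
    finPart (↥(maximalRealSubfield L)) L (IsCMField.complexConj L) N (Matrix.diagonal dV)
        (ιA (finAdelicToAdelic (↥(maximalRealSubfield L)) L (IsCMField.complexConj L) N H k)) =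
      (finAdelicCongr (↥(maximalRealSubfield L)) L (IsCMField.complexConj L) g ht hg).symm k :=
  Subtype.ext ((coe_finPart_pin L N H dV g ιA hιA k).trans (coe_finAdelicCongr_symm_apply _ L _ g ht hg k).symm)

include hιA in
/-- **`ιA (1, k) = (1, (finAdelicCongr … g ht hg).symm k)`**: the pinned transport of a finite-adelic element is finite-adelic (★
`cmAdelicFrameTransport_finAdelicToAdelic` for `t • H`, §1, §2 and `finPart_pin_eq_finAdelicCongr_symm`). [cite: BorelJacquet1979, §4.1] -/
theorem pin_finAdelicToAdelic (k : finAdelic (↥(maximalRealSubfield L)) L (IsCMField.complexConj L) N H) :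
    ιA (finAdelicToAdelic (↥(maximalRealSubfield L)) L (IsCMField.complexConj L) N H k) =
      finAdelicToAdelic (↥(maximalRealSubfield L)) L (IsCMField.complexConj L) N (Matrix.diagonal dV)
        ((finAdelicCongr (↥(maximalRealSubfield L)) L (IsCMField.complexConj L) g ht hg).symm k) := by
  rw [pin_apply L N H dV t ht g hg ιA hιA, finAdelicToAdelic_inclusion L N H t ht k, cmAdelicFrameTransport_finAdelicToAdelic]
  congr 1
  exact Subtype.ext (by rw [coe_finPart_cmAdelicFrameTransport_finAdelicToAdelic, coe_finAdelicCongr_symm_apply])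

end Summit.HodgeConjecture.HodgeConjecture.Cruxes.HLiu418.F0LD2FrameTransportPin

end
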